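import Mathlib
import HarnessLib
import Summits.HubbardSuperconductivity.HubbardSuperconductivity.Theorems.KLProgrammeKLRegimeVolumeLimitHOscOfChildren

/-!
# Route `KLProgramme` — VL item stmt-HubbardSuperconductivity-23356 `KLRegimeVolumeLimitV17F3`, atom «HOsc» in the TOWER-BOUND binder order of
# `…TwoVolumeSrcTowerProducerT` (k3c4-p1 g19, p680765): «(VL)-HOSC-BRIDGE», tower-bound form (cell gate-hubbard-kl, seat p2 g25)

`…TwoVolumeSrcTowerProducerT` asks the (K5′) clauses TOWER-BOUND (`HOscT`: `∀ G P Q R, … → TowerP klPredsV17F2 G P Q R β U μ K Lstar Mstar → ∃ L₂ M₂, …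
FlowPieceOscAt L M (klReadOscC P R) β U μ m`).  As for the history-free `HOsc` (located «(VL)-HOSC-PREFIX», …VolumeLimitHOscOfChildren), the (P,R)-keyed
constant is not reachable from the K3 material, and the tower hypothesis at a generic `(G, Q)` cannot feed the registered (C) row (keyed at the engine tokens);
what the children + the engine-with-osc-export DO give is the same statement with an EXISTENTIAL constant — here in the tower-bound binder order:
* **`hoscTAtom_of_children`** — `BetaSplitP klPredsV17F2 klWindowC → CountertermP2 klPredsV17F2 klWindowC → ENG-OSC → HOscT′`, where HOscT′ is `HOscT` with
  `klReadOscC P R ↦ c″` bound by `∃ c″ : ℝ, 0 ≤ c″ ∧` right after `R.WF2 →` (the tower hypothesis is accepted and not used: `hoscAtom_of_children` already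
  gives the clauses history-free).
Pure composition; nothing here asserts HOscT′, any stub of 20437, VL, K3 or superconductivity.
References: BGM 2006 §2.4 (2.36) [cite: BenfattoGiulianiMastropietro2006].
-/

noncomputable section

namespace Summit.HubbardSuperconductivity.HubbardSuperconductivity.Theorems.KLRegimeSplit

set_option linter.dupNamespace false -- summit = problem name (single-conjunct summit), D-0017

open Real Literature.MathematicalPhysics.QuantumLattice Literature.Probability.LatticeModels
open Literature.MathematicalPhysics.QuantumLattice.FermiRG
open Summit.HubbardSuperconductivity.HubbardSuperconductivity.Theorems.KLProgrammeLegKernels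
open Summit.HubbardSuperconductivity.HubbardSuperconductivity.Theorems.DispersionFlow

/-- **«(VL)-HOSC-BRIDGE», TOWER-BOUND BINDER ORDER: HOscT′ FROM THE THREE K3 CHILDREN.**  Children 1, 2 (✓) and the engine text with the (K5′) osc export give,
for every `(G, P, Q, R)` (dummies), `∃ c″ ≥ 0, ∃ c₇ > 0, ∀ 0 < c ≤ c₇, ∃ U₇ > 0, ∀ μ U β` (regime), `∀ K Lstar Mstar, TowerP … →` (unused) `∃ L₂ M₂, ∀ L M ≥ …,
∀ 1 ≤ m < n_β + 1, FlowPieceOscAt L M c″ β U μ m`. [cite: BenfattoGiulianiMastropietro2006, §2.4 (2.36)] -/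
theorem hoscTAtom_of_children (h₁ : BetaSplitP klPredsV17F2 klWindowC) (h₂ : CountertermP2 klPredsV17F2 klWindowC)
    (hE : ∃ G : GeoConsts, G.WF ∧ ∀ P : SplitConsts, P.WF → ∀ R : RenConsts, R.WF2 → ∃ Q : EngConsts, Q.WF ∧ ∃ c₃ : ℝ, 0 < c₃ ∧
      ∃ c'' : ℝ, 0 ≤ c'' ∧ ∀ c : ℝ, 0 < c → c ≤ c₃ →
        ∃ U₀ : ℝ, 0 < U₀ ∧ ∃ L₃ : ℝ → ℝ → ℕ, ∃ M₃ : ℝ → ℝ → ℕ → ℕ,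
          ∀ μ ∈ klWindowC, ∀ U : ℝ, 0 < U → U ≤ U₀ → ∀ β : ℝ, klBetaMin ≤ β → β ≤ Real.exp (c / U ^ 2) →
            ∀ K : TrigPolyC4v, klPredsV17F2.frameOK R U (nScales β) μ K →
              ∀ (L M : ℕ) [NeZero L] [NeZero M], L₃ β U ≤ L → M₃ β U L ≤ M →
                ∀ n : ℕ, n ≤ nScales β + 1 → IsKLRegime U c (-(n : ℤ)) → HistP klPredsV17F2 L M G P Q R β U μ K n →
                  (klPredsV17F2.engine L M G P Q β U μ K n ∧ klPredsV17F2.twoLeg L M G P Q R β U μ K n) ∧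
                    ∀ m : ℕ, 1 ≤ m → m < n → FlowPieceOscAt L M c'' β U μ m) :
    ∀ (G : GeoConsts) (P : SplitConsts) (Q : EngConsts) (R : RenConsts), P.WF → R.WF2 →
      ∃ c'' : ℝ, 0 ≤ c'' ∧ ∃ c₇ : ℝ, 0 < c₇ ∧ ∀ c : ℝ, 0 < c → c ≤ c₇ → ∃ U₇ : ℝ, 0 < U₇ ∧
        ∀ μ ∈ klWindowC, ∀ U : ℝ, 0 < U → U ≤ U₇ → ∀ β : ℝ, klBetaMin ≤ β → β ≤ Real.exp (c / U ^ 2) →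
          ∀ (K : TrigPolyC4v) (Lstar : ℕ) (Mstar : ℕ → ℕ), TowerP klPredsV17F2 G P Q R β U μ K Lstar Mstar →
          ∃ L₂ : ℕ, ∃ M₂ : ℕ → ℕ, ∀ (L M : ℕ) [NeZero L] [NeZero M], L₂ ≤ L → M₂ L ≤ M →
            ∀ m : ℕ, 1 ≤ m → m < nScales β + 1 → FlowPieceOscAt L M c'' β U μ m := by
  intro G P Q R hP hR
  obtain ⟨c'', hc'', c₇, hc₇, h⟩ := hoscAtom_of_children h₁ h₂ hE P R hP hR
  refine ⟨c'', hc'', c₇, hc₇, fun c hc hc7 => ?_⟩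
  obtain ⟨U₇, hU₇, h'⟩ := h c hc hc7
  exact ⟨U₇, hU₇, fun μ hμ U hU hUle β hβ hβc _ _ _ _ => h' μ hμ U hU hUle β hβ hβc⟩

end Summit.HubbardSuperconductivity.HubbardSuperconductivity.Theorems.KLRegimeSplit

end
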